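import Summits.MatrixMultiplication.MatrixMultiplication.Theorems.CatalyticDegenerationCatalyticTransfer
import Literature.Computability.AlgebraicComplexity.TensorRestrictionRank
import Literature.Computability.AlgebraicComplexity.AsymptoticRankMatMul

/-!
# Strategy census for the deciding crux `CatalyticRate` (stmt-MatrixMultiplication-3634) —
typed pieces of every attempted decomposition, with kernel-checked verdicts

Companion to `Cruxes/CatalyticRate/STRATEGY-CENSUS.md` and `Cruxes/CatalyticRate/Equivalence.lean`.
Every candidate piece `Xᵢ` of a split `X₁ ∧ … ∧ X_k → CatalyticRate` is typed here; where the piece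
is (in substance) the summit again, the equivalence `Xᵢ ↔ MatrixMultiplication` is PROVED below
(criterion (c) of the BC2 redirect exemption then fails for that piece, exactly as it failed for
`CatalyticRate` itself).  Pieces that are typed but carry no theorem are discussed in the census
(criteria (a)/(b)).  No `sorry`, no axioms beyond the standard three.
-/

noncomputable section

-- the tree's namespace `Summit.MatrixMultiplication.MatrixMultiplication.…` repeats a component by design (D-0017)
set_option linter.dupNamespace false

namespace Summit.MatrixMultiplication.MatrixMultiplication.Cruxes.CatalyticRate.Census

open Literature.Computability.AlgebraicComplexity
open Literature.Barriers.MatrixMultiplication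
open Summit.MatrixMultiplication.MatrixMultiplication.Theses.CatalyticDegeneration
open Summit.MatrixMultiplication.MatrixMultiplication.Theorems

/-! ## Exponent bookkeeping -/

/-- `4^{(1+ε)k} = (2^k)^{2(1+ε)}` (real exponents). [folklore] -/
theorem four_rpow_eq (ε : ℝ) (k : ℕ) :
    (4 : ℝ) ^ ((1 + ε) * k) = (((2 : ℕ) ^ k : ℕ) : ℝ) ^ (2 * (1 + ε)) := by
  push_cast
  rw [show (4 : ℝ) = (2 : ℝ) ^ (2 : ℝ) by norm_num, ← Real.rpow_mul (by norm_num : (0 : ℝ) ≤ 2),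
    ← Real.rpow_natCast 2 k, ← Real.rpow_mul (by norm_num : (0 : ℝ) ≤ 2)]
  congr 1
  ring

/-- Absorbing a constant: `0 < A`, `0 < ε`, `log₂ A / ε < k` give `A·(2^k)^{2+ε} ≤ 4^{(1+ε)k}`.
[folklore] -/
theorem const_mul_rpow_le_four_rpow {A ε : ℝ} {k : ℕ} (hA : 0 < A) (hε : 0 < ε)
    (hk : Real.logb 2 A / ε < k) :
    A * (((2 : ℕ) ^ k : ℕ) : ℝ) ^ (2 + ε) ≤ (4 : ℝ) ^ ((1 + ε) * k) := by
  have hlt : Real.logb 2 A < ε * k := by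
    rw [div_lt_iff₀ hε] at hk
    linarith [mul_comm (k : ℝ) ε]
  have hA2 : A ≤ (2 : ℝ) ^ (ε * k) := by
    have h := Real.rpow_le_rpow_of_exponent_le (by norm_num : (1 : ℝ) ≤ 2) hlt.le
    rwa [Real.rpow_logb (by norm_num) (by norm_num) hA] at h
  have hn : (((2 : ℕ) ^ k : ℕ) : ℝ) = (2 : ℝ) ^ (k : ℝ) := by
    push_cast
    exact (Real.rpow_natCast 2 k).symm
  have hpos : (0 : ℝ) ≤ (((2 : ℕ) ^ k : ℕ) : ℝ) ^ (2 + ε) := by positivity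
  calc A * (((2 : ℕ) ^ k : ℕ) : ℝ) ^ (2 + ε)
      ≤ (2 : ℝ) ^ (ε * k) * (((2 : ℕ) ^ k : ℕ) : ℝ) ^ (2 + ε) :=
        mul_le_mul_of_nonneg_right hA2 hpos
    _ = (4 : ℝ) ^ ((1 + ε) * k) := by
        rw [hn, ← Real.rpow_mul (by norm_num : (0 : ℝ) ≤ 2), ← Real.rpow_add (by norm_num : (0 : ℝ) < 2),
          show (4 : ℝ) = (2 : ℝ) ^ (2 : ℝ) by norm_num, ← Real.rpow_mul (by norm_num : (0 : ℝ) ≤ 2)]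
        congr 1
        ring

/-! ## D7 — catalyst-class variants: plain rank rate (no catalyst, restriction) and unit catalysts -/

/-- Piece (D7a) `RankRate`: the RANK rate of `⟨2^k,2^k,2^k⟩` is `4` — no catalyst, restriction in
place of degeneration (Bini-free, Schönhage-free). -/
def RankRate : Prop :=
  ∀ ε : ℝ, 0 < ε → ∃ k r : ℕ, 1 ≤ k ∧ 1 ≤ r ∧ (r : ℝ) ≤ (4 : ℝ) ^ ((1 + ε) * k) ∧
    TensorRestrictsTo (unitTensor ℂ r) (matMulTensor ℂ (2 ^ k) (2 ^ k) (2 ^ k))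

/-- Piece (D7b) `UnitCatalyticRate`: catalytic rate with UNIT catalysts `C = ⟨c⟩` only
(Landsberg's Problem-2 regime: border-rank additivity of a unit summand). -/
def UnitCatalyticRate : Prop :=
  ∀ ε : ℝ, 0 < ε → ∃ k r c : ℕ, 1 ≤ k ∧ 1 ≤ r ∧ (r : ℝ) ≤ (4 : ℝ) ^ ((1 + ε) * k) ∧
    PolyDegeneratesTo (directSumTensor (unitTensor ℂ r) (unitTensor ℂ c))
      (directSumTensor (matMulTensor ℂ (2 ^ k) (2 ^ k) (2 ^ k)) (unitTensor ℂ c))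

/-- `ω(ℂ) = 2 → RankRate`: `R(⟨n,n,n⟩) ≤ A n^{2+ε}`, a rank bound is a restriction from the unit
tensor, and the constant is absorbed for `k > log₂ A / ε`. [folklore] -/
theorem rankRate_of_matrixMultiplication (hS : _root_.MatrixMultiplication) : RankRate := by
  intro ε hε
  have hω : omega ℂ = 2 := (_root_.MatrixMultiplication_iff).1 hS
  obtain ⟨A, hA, hAb⟩ := exists_tensorRank_matMulTensor_le_rpow ℂ hε
  obtain ⟨k₀, hk₀⟩ := exists_nat_gt (Real.logb 2 A / ε)
  have hk : Real.logb 2 A / ε < ((k₀ + 1 : ℕ) : ℝ) := hk₀.trans (by push_cast; linarith)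
  have hn1 : 1 ≤ 2 ^ (k₀ + 1) := Nat.one_le_two_pow
  refine ⟨k₀ + 1, tensorRank (matMulTensor ℂ (2 ^ (k₀ + 1)) (2 ^ (k₀ + 1)) (2 ^ (k₀ + 1))),
    Nat.succ_le_succ (Nat.zero_le _), ?_, ?_, tensorRestrictsTo_unitTensor_of_tensorRank_le _ le_rfl⟩
  · exact (Nat.one_le_pow _ _ hn1).trans (matMulTensor_sq_le_tensorRank ℂ (2 ^ (k₀ + 1)))
  · have h1 := hAb (2 ^ (k₀ + 1)) hn1
    rw [hω] at h1
    exact h1.trans (const_mul_rpow_le_four_rpow hA hε hk)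

/-- `RankRate → UnitCatalyticRate` (restriction is a degeneration; add the catalyst `⟨0⟩`). [folklore] -/
theorem unitCatalyticRate_of_rankRate (h : RankRate) : UnitCatalyticRate := by
  intro ε hε
  obtain ⟨k, r, hk, hr, hrle, hres⟩ := h ε hε
  exact ⟨k, r, 0, hk, hr, hrle,
    polyDegeneratesTo_directSum hres.polyDegeneratesTo (polyDegeneratesTo_refl _)⟩

/-- `UnitCatalyticRate → CatalyticRate` (a unit catalyst is a catalyst). [folklore] -/
theorem catalyticRate_of_unitCatalyticRate (h : UnitCatalyticRate) : CatalyticRate := by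
  intro ε hε
  obtain ⟨k, r, c, hk, hr, hrle, hdeg⟩ := h ε hε
  exact ⟨k, r, c, c, c, unitTensor ℂ c, hk, hr, hrle, hdeg⟩

/-- `CatalyticRate → ω(ℂ) = 2` (the route's `closes` with the proved transfer). [folklore] -/
theorem matrixMultiplication_of_catalyticRate (h : CatalyticRate) : _root_.MatrixMultiplication :=
  closes catalyticTransfer_proof h

/-- **(D7a) `RankRate ↔ MatrixMultiplication`.** [folklore] -/
theorem rankRate_iff : RankRate ↔ _root_.MatrixMultiplication :=
  ⟨fun h => matrixMultiplication_of_catalyticRate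
    (catalyticRate_of_unitCatalyticRate (unitCatalyticRate_of_rankRate h)),
   rankRate_of_matrixMultiplication⟩

/-- **(D7b) `UnitCatalyticRate ↔ MatrixMultiplication`.** [folklore] -/
theorem unitCatalyticRate_iff : UnitCatalyticRate ↔ _root_.MatrixMultiplication :=
  ⟨fun h => matrixMultiplication_of_catalyticRate (catalyticRate_of_unitCatalyticRate h),
   fun h => unitCatalyticRate_of_rankRate (rankRate_of_matrixMultiplication h)⟩

/-- **`CatalyticRate ↔ MatrixMultiplication`** (again, via the chain). [folklore] -/
theorem catalyticRate_iff : CatalyticRate ↔ _root_.MatrixMultiplication :=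
  ⟨matrixMultiplication_of_catalyticRate, fun h =>
    catalyticRate_of_unitCatalyticRate (unitCatalyticRate_of_rankRate (rankRate_of_matrixMultiplication h))⟩

/-! ## D1 — base-change split: rate along arbitrary bases `n` -/

/-- Piece (D1) `GeneralBaseRate`: catalytic rate `2` along SOME bases `n ≥ 2` (not necessarily
powers of two): for every `ε > 0` a catalytic identity `⟨r⟩ ⊕ C ⊵ ⟨n,n,n⟩ ⊕ C` with `r ≤ n^{2+ε}`.
(The other piece of D1, `BaseChange` — a catalytic identity at base `n` yields one at base `2^k`
with the same exponent up to `o(1)`, by Kronecker closure and zero-padding — is provable.) -/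
def GeneralBaseRate : Prop :=
  ∀ ε : ℝ, 0 < ε → ∃ (n r a b c : ℕ) (C : Fin a → Fin b → Fin c → ℂ), 2 ≤ n ∧ 1 ≤ r ∧
    (r : ℝ) ≤ (n : ℝ) ^ (2 + ε) ∧
    PolyDegeneratesTo (directSumTensor (unitTensor ℂ r) C) (directSumTensor (matMulTensor ℂ n n n) C)

/-- `GeneralBaseRate → ω(ℂ) = 2` (catalytic transfer at base `n`: `ω ≤ log_n r ≤ 2 + ε`). [folklore] -/
theorem matrixMultiplication_of_generalBaseRate (h : GeneralBaseRate) : _root_.MatrixMultiplication := by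
  rw [_root_.MatrixMultiplication_iff]
  refine le_antisymm (le_of_forall_pos_le_add fun δ hδ => ?_) (omega_two_le ℂ)
  obtain ⟨n, r, a, b, c, C, hn, hr, hrle, hdeg⟩ := h δ hδ
  refine (catalyticTransfer_proof n r a b c C hn hr hdeg).trans ?_
  have hn1 : (1 : ℝ) < n := by exact_mod_cast hn
  have hr0 : (0 : ℝ) < r := by exact_mod_cast hr
  calc Real.logb n r ≤ Real.logb n ((n : ℝ) ^ (2 + δ)) := Real.logb_le_logb_of_le hn1 hr0 hrle
    _ = 2 + δ := Real.logb_rpow (by positivity) hn1.ne'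

/-- `ω(ℂ) = 2 → GeneralBaseRate` (bases `2^k`, from `CatalyticRate` at `ε/2`). [folklore] -/
theorem generalBaseRate_of_matrixMultiplication (hS : _root_.MatrixMultiplication) : GeneralBaseRate := by
  intro ε hε
  obtain ⟨k, r, a, b, c, C, hk, hr, hrle, hdeg⟩ := catalyticRate_iff.2 hS (ε / 2) (by positivity)
  refine ⟨2 ^ k, r, a, b, c, C, ?_, hr, ?_, hdeg⟩
  · calc 2 = 2 ^ 1 := (pow_one 2).symm
      _ ≤ 2 ^ k := Nat.pow_le_pow_right (by norm_num) hk
  · rw [four_rpow_eq] at hrle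
    convert hrle using 2
    ring

/-- **(D1) `GeneralBaseRate ↔ MatrixMultiplication`.** [folklore] -/
theorem generalBaseRate_iff : GeneralBaseRate ↔ _root_.MatrixMultiplication :=
  ⟨matrixMultiplication_of_generalBaseRate, generalBaseRate_of_matrixMultiplication⟩

/-! ## D2 — asymptotic-rank split (Vergleichsstellensatz shape) -/

/-- Piece (D2a) `SpectralRate`: the asymptotic rank of `⟨2^k,2^k,2^k⟩` is eventually STRICTLY below
an admissible `r ≤ 4^{(1+ε)k}` — the spectral half of "strict spectral domination ⇒ catalytic
degeneration". -/
def SpectralRate : Prop :=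
  ∀ ε : ℝ, 0 < ε → ∃ k r : ℕ, 1 ≤ k ∧ (r : ℝ) ≤ (4 : ℝ) ^ ((1 + ε) * k) ∧
    asymptoticRank (matMulTensor ℂ (2 ^ k) (2 ^ k) (2 ^ k)) < r

/-- Piece (D2b) `CatalyticVergleich`: an exact `⊕`-catalytic Vergleichsstellensatz for 3-tensors —
strict domination of the asymptotic rank by `r` forces a catalytic degeneration from `⟨r⟩`.
(Typed for the record; the census argues it is REFUTED modulo the route's own crux `KoszulCancels`:
at `t = ⟨3,3,3⟩` it would give `bR^cat ≤ ⌊3^ω⌋ + 1 ≤ 14 < 15 = 2·3² − 3`.) -/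
def CatalyticVergleich : Prop :=
  ∀ (a b c r : ℕ) (t : Fin a → Fin b → Fin c → ℂ), asymptoticRank t < r →
    ∃ (a' b' c' : ℕ) (C : Fin a' → Fin b' → Fin c' → ℂ),
      PolyDegeneratesTo (directSumTensor (unitTensor ℂ r) C) (directSumTensor t C)

/-- `SpectralRate → ω(ℂ) = 2`: `(2^k)^ω = R̃(⟨2^k⟩) < r ≤ (2^k)^{2+2ε}` gives `ω < 2 + 2ε`. [folklore] -/
theorem matrixMultiplication_of_spectralRate (h : SpectralRate) : _root_.MatrixMultiplication := by
  rw [_root_.MatrixMultiplication_iff]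
  refine le_antisymm (le_of_forall_pos_le_add fun δ hδ => ?_) (omega_two_le ℂ)
  obtain ⟨k, r, hk, hrle, hlt⟩ := h (δ / 2) (by positivity)
  have hq : 1 ≤ 2 ^ k := Nat.one_le_two_pow
  rw [asymptoticRank_matMulTensor ℂ (2 ^ k) hq, four_rpow_eq] at *
  have h1 : (((2 : ℕ) ^ k : ℕ) : ℝ) ^ omega ℂ < (((2 : ℕ) ^ k : ℕ) : ℝ) ^ (2 * (1 + δ / 2)) :=
    hlt.trans_le hrle
  have h2k : 2 ≤ 2 ^ k := by
    calc 2 = 2 ^ 1 := (pow_one 2).symm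
      _ ≤ 2 ^ k := Nat.pow_le_pow_right (by norm_num) hk
  have hbase : (1 : ℝ) < (((2 : ℕ) ^ k : ℕ) : ℝ) := by exact_mod_cast h2k
  have := (Real.rpow_lt_rpow_left_iff hbase).1 h1
  linarith

/-- `ω(ℂ) = 2 → SpectralRate`: `R̃(⟨2^k⟩) = 4^k < 4^k + 1 ≤ 4^{(1+ε)k}` once `4^{εk} ≥ 2`. [folklore] -/
theorem spectralRate_of_matrixMultiplication (hS : _root_.MatrixMultiplication) : SpectralRate := by
  intro ε hε
  have hω : omega ℂ = 2 := (_root_.MatrixMultiplication_iff).1 hS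
  obtain ⟨k₀, hk₀⟩ := exists_nat_gt (1 / (2 * ε))
  have hk : 1 / (2 * ε) < ((k₀ + 1 : ℕ) : ℝ) := hk₀.trans (by push_cast; linarith)
  refine ⟨k₀ + 1, 4 ^ (k₀ + 1) + 1, Nat.succ_le_succ (Nat.zero_le _), ?_, ?_⟩
  · -- `4^k + 1 ≤ 2 · 4^k ≤ 4^{εk} · 4^k = 4^{(1+ε)k}`
    have h2 : (2 : ℝ) ≤ (4 : ℝ) ^ (ε * ((k₀ + 1 : ℕ) : ℝ)) := by
      have h1 : (1 : ℝ) ≤ 2 * (ε * ((k₀ + 1 : ℕ) : ℝ)) := by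
        rw [div_lt_iff₀ (by positivity)] at hk
        nlinarith
      have h := Real.rpow_le_rpow_of_exponent_le (by norm_num : (1 : ℝ) ≤ 2) h1
      rw [Real.rpow_one] at h
      rwa [show (4 : ℝ) = (2 : ℝ) ^ (2 : ℝ) by norm_num,
        ← Real.rpow_mul (by norm_num : (0 : ℝ) ≤ 2)]
    have h4 : (1 : ℝ) ≤ (4 : ℝ) ^ (k₀ + 1) := one_le_pow₀ (by norm_num)
    calc (((4 : ℕ) ^ (k₀ + 1) + 1 : ℕ) : ℝ) = (4 : ℝ) ^ (k₀ + 1) + 1 := by push_cast; ring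
      _ ≤ 2 * (4 : ℝ) ^ (k₀ + 1) := by linarith
      _ ≤ (4 : ℝ) ^ (ε * ((k₀ + 1 : ℕ) : ℝ)) * (4 : ℝ) ^ (k₀ + 1) :=
          mul_le_mul_of_nonneg_right h2 (by positivity)
      _ = (4 : ℝ) ^ ((1 + ε) * ((k₀ + 1 : ℕ) : ℝ)) := by
          rw [← Real.rpow_natCast (4 : ℝ) (k₀ + 1), ← Real.rpow_add (by norm_num : (0 : ℝ) < 4)]
          congr 1
          push_cast
          ring
  · rw [asymptoticRank_matMulTensor ℂ _ Nat.one_le_two_pow, hω]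
    have hsq : (((2 : ℕ) ^ (k₀ + 1) : ℕ) : ℝ) ^ (2 : ℝ) = (4 : ℝ) ^ (k₀ + 1) := by
      rw [Real.rpow_two]
      push_cast
      rw [← pow_mul, mul_comm, pow_mul]
      norm_num
    rw [hsq]
    push_cast
    linarith

/-- **(D2a) `SpectralRate ↔ MatrixMultiplication`.** [folklore] -/
theorem spectralRate_iff : SpectralRate ↔ _root_.MatrixMultiplication :=
  ⟨matrixMultiplication_of_spectralRate, spectralRate_of_matrixMultiplication⟩

/-! ## D3 — strict seed + quantitative self-improvement (typed only; see census) -/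

/-- Piece (D3a) `MatmulStrictCatalysis` (= the route's `NonCancellation` specialised to a matrix
multiplication target): some `⟨n,n,n⟩`, `n ≥ 2`, admits a STRICTLY catalytic identity. -/
def MatmulStrictCatalysis : Prop :=
  ∃ (n r a b c : ℕ) (C : Fin a → Fin b → Fin c → ℂ), 2 ≤ n ∧
    PolyDegeneratesTo (directSumTensor (unitTensor ℂ r) C) (directSumTensor (matMulTensor ℂ n n n) C) ∧
    ¬ PolyDegeneratesTo (unitTensor ℂ r) (matMulTensor ℂ n n n)

/-- Piece (D3b) `StrictCatalysisImproves` (an INVENTED local amplification step, recorded to show why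
it is rejected): a strictly catalytic identity of exponent `β = log_n r` spawns, at some Kronecker
scale `n^m` (`m ≥ 2`), a strictly catalytic identity of exponent `≤ (β + 2)/2`, i.e.
`r'² ≤ (n^m)² · r^m`. -/
def StrictCatalysisImproves : Prop :=
  ∀ (n r a b c : ℕ) (C : Fin a → Fin b → Fin c → ℂ), 2 ≤ n →
    PolyDegeneratesTo (directSumTensor (unitTensor ℂ r) C) (directSumTensor (matMulTensor ℂ n n n) C) →
    ¬ PolyDegeneratesTo (unitTensor ℂ r) (matMulTensor ℂ n n n) →
    ∃ (m r' a' b' c' : ℕ) (C' : Fin a' → Fin b' → Fin c' → ℂ), 2 ≤ m ∧ r' ^ 2 ≤ (n ^ m) ^ 2 * r ^ m ∧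
      PolyDegeneratesTo (directSumTensor (unitTensor ℂ r') C')
        (directSumTensor (matMulTensor ℂ (n ^ m) (n ^ m) (n ^ m)) C') ∧
      ¬ PolyDegeneratesTo (unitTensor ℂ r') (matMulTensor ℂ (n ^ m) (n ^ m) (n ^ m))

/-! ## D4 — through an intermediate family `T k` (typed schema; see census) -/

/-- Piece (D4a) `CheapFamily T d`: the family `T k` (of formats `d k`) is catalytically cheap:
rate exponent `1` in `d k`. -/
def CheapFamily (d : ℕ → ℕ) (T : ∀ k : ℕ, Fin (d k) → Fin (d k) → Fin (d k) → ℂ) : Prop :=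
  ∀ ε : ℝ, 0 < ε → ∃ᶠ k in Filter.atTop, ∃ (r a b c : ℕ) (C : Fin a → Fin b → Fin c → ℂ),
    (r : ℝ) ≤ (d k : ℝ) ^ (1 + ε) ∧
    PolyDegeneratesTo (directSumTensor (unitTensor ℂ r) C) (directSumTensor (T k) C)

/-- Piece (D4b) `RichFamily T d`: the family catalytically degenerates to near-full-size matrix
multiplication (`m² ≥ d^{1-ε}`). -/
def RichFamily (d : ℕ → ℕ) (T : ∀ k : ℕ, Fin (d k) → Fin (d k) → Fin (d k) → ℂ) : Prop :=
  ∀ ε : ℝ, 0 < ε → ∀ᶠ k in Filter.atTop, ∃ (m a b c : ℕ) (C : Fin a → Fin b → Fin c → ℂ), 2 ≤ m ∧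
    (d k : ℝ) ^ (1 - ε) ≤ (m : ℝ) ^ 2 ∧
    PolyDegeneratesTo (directSumTensor (T k) C) (directSumTensor (matMulTensor ℂ m m m) C)

#print axioms catalyticRate_iff
#print axioms generalBaseRate_iff
#print axioms spectralRate_iff
#print axioms unitCatalyticRate_iff
#print axioms rankRate_iff

end Summit.MatrixMultiplication.MatrixMultiplication.Cruxes.CatalyticRate.Census

end
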